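import Literature.Barriers.SmoothPoincare4.ExoticContractibleRelativelyExoticProofs
import Literature.Barriers.SmoothPoincare4.ExoticContractibleCorkHomeomorphProofs
import Literature.Barriers.SmoothPoincare4.ExoticContractibleSymmetryKillingCore
import Literature.Barriers.SmoothPoincare4.ExoticContractibleUniverseProofs
import HarnessLib

/-!
# Akbulut–Ruberman's Thm. B from two named leaves: a cork and the symmetry-killing cobordism

Sibling proof file of `Literature/Barriers/SmoothPoincare4/ExoticContractible.lean` (provefact
seat of the named fact `Literature.Barriers.SmoothPoincare4.akbulutRuberman2016_theoremB`,
S. Akbulut, D. Ruberman, *Absolutely exotic compact 4-manifolds*, Comment. Math. Helv. 91 (2016)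
1–19, Thm. B, first assertion). Everything here is PROVED; no definitions, no named facts.

## The point

The printed proof of Thm. B is one paragraph (§3): "Apply Theorem A to `(W, τ)`, a cork … This
gives a pair of non-diffeomorphic manifolds `V` and `V′` with the same boundary … But Freedman's
theorem says that `V` and `V′` are in fact homeomorphic."  In the tree the proof of Thm. A for a
contractible `W` is assembled from four parts (`ExoticContractibleTheoremAProofs.lean`):
(C) `akbulutRuberman2016_symmetryKillingCobordism` (§3 ¶1 with the Claim: Lemma 2.3, Cor. 2.5,
Prop. 2.6, JSJ/Waldhausen), (G) `Literature.Topology.FourManifolds.exists_cobordismAttachment`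
(Milnor 1965, Thm. 1.4: `W ∪_ψ X` exists), (R) `akbulutRuberman2016_relativelyExotic` (the
"(E:twist)" paragraph) and (S) `akbulutRuberman2016_boundaryDiffeosExtend` ("By the claim above
and Lemma 1.2").  Three of the four are now theorems of the tree:

* (G) `Literature.Topology.FourManifolds.exists_cobordismAttachment_holds`
  (`CobordismAttachmentProofs.lean`),
* (S) `akbulutRuberman2016_boundaryDiffeosExtend_holds` (`ExoticContractibleBoundaryDiffeosProofs.lean`),
* (R) `akbulutRuberman2016_relativelyExotic_holds` (`ExoticContractibleRelativelyExoticProofs.lean`),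

and the appeal to Freedman's theorem for the homeomorphism `V ≃ₜ V′` is unnecessary when the
input of Thm. A is a cork (`ExoticContractibleCorkHomeomorphProofs.lean`: the boundary twist of a
cork extends to a self-homeomorphism `F` of `W`, and `F ∪ id_X : W ∪_f X → W ∪_{id} X` is a
homeomorphism).  This file records the resulting state of the route as theorems:

* `akbulutRuberman2016_theoremA_contractible_of_symmetryKilling` — **Thm. A (contractible `W`)
  from (C) alone.**
* `akbulutRuberman2016_theoremB_of_cork_symmetryKilling` — **Thm. B from exactly two named
  leaves**: the cork fact `akbulut1991_mazurCork` (Akbulut 1991, Thms. 1-2) and (C).  With the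
  barrier: `contractibleBarrierFour_of_cork_symmetryKilling`,
  `contractibleBarrierFour_of_isCork_symmetryKilling` (any cork in the tree's sense `IsCork`).
* `akbulutRuberman2016_theoremB_of_cork_homologyCobordismCore` — the same with (C) replaced by
  its inline geometric core (`akbulutRuberman2016_symmetryKillingCobordism_of_homologyCobordism`,
  `ExoticContractibleSymmetryKillingCore.lean`): the outputs of Lemma 2.3 (an invertible
  cobordism `X` out of `∂W`, `∂W → X` an isomorphism on `H_*(-; ℤ)` and onto on `π₁`) and of the
  Claim (`FarEndDiffeosExtend X`) — i.e. Thm. B from a cork and the 3-manifold inputs of the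
  paper (hyperbolic links with trivial symmetry group, the doubly slice knot `11n42`, JSJ and
  Waldhausen), everything else in the printed proofs of Thms. A and B being formal.
* The alternative leaf sets below the cork fact, for the record:
  `akbulutRuberman2016_theoremB_of_notExtendsToDiffeomorph_freedmanQuinn_symmetryKilling`
  (Akbulut 1991, Thm. 2 = `akbulut1991_notExtendsToDiffeomorph`, Freedman–Quinn 11.1C =
  `freedmanQuinn1990_homeomorph_extends_contractible`, and (C)) and
  `akbulutRuberman2016_theoremB_of_theorem11_freedmanQuinn_symmetryKilling` (Kang 2022, Thm. 1.1 =
  `kang2022_theorem11` and Freedman–Quinn at universe `0`, and (C) at the target universe).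

The other route of the tree to Thm. B (S. Kang 2022, Cor. 1.2) has the single named leaf
`kang2022_corollary12` at every universe
(`akbulutRuberman2016_theoremB_univ_of_kang2022_corollary12`, `ExoticContractibleUniverse.lean`).
Every remaining leaf of either route is gauge- or Floer-theoretic (the cork fact; Kang's
corollary), 3-manifold-geometric with certified computation ((C)), or Freedman's disc embedding
theorem; none has vocabulary in Mathlib or the tree, which is why the discharge
`akbulutRuberman2016_theoremB_holds` is not attempted here (provefact triage `XL`).

## References

* S. Akbulut, D. Ruberman, *Absolutely exotic compact 4-manifolds*, Comment. Math. Helv. 91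
  (2016) 1–19 = arXiv:1410.1461v3, Thms. A, B, Lemma 2.3 and §3. [AkbulutRuberman2016]
* S. Akbulut, *A fake compact contractible 4-manifold*, J. Differential Geom. 33 (1991) 335–356,
  Thms. 1-2. [Akbulut1991Fake]
* M. H. Freedman, F. Quinn, *Topology of 4-manifolds*, Princeton (1990), Prop. 11.1C, Cor. 9.3C.
  [FreedmanQuinn1990]
* S. Kang, *One stabilization is not enough for contractible 4-manifolds*, arXiv:2210.07510
  (2022), Thm. 1.1, Cor. 1.2. [Kang2022OneStabilization]
-/

noncomputable section

open scoped Manifold ContDiff Topology ContinuousMap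
open Function Set CategoryTheory
open Literature.Topology.FourManifolds Literature.AlgebraicTopology.Homotopy
  Literature.AlgebraicTopology.SingularHomology

namespace Literature.Barriers.SmoothPoincare4

universe u

/-! ### Thm. A (contractible `W`) from (C) alone -/

/-- **Akbulut–Ruberman 2016, Thm. A for contractible `W`, from the symmetry-killing cobordism
(C) alone**: the parts (G), (R), (S) of `akbulutRuberman2016_theoremA_contractible_of_parts` are
the tree's theorems `exists_cobordismAttachment_holds`,
`akbulutRuberman2016_relativelyExotic_holds`, `akbulutRuberman2016_boundaryDiffeosExtend_holds`.
[cite: AkbulutRuberman2016, Thm. A and §3 (proof of Thm. A)] -/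
theorem akbulutRuberman2016_theoremA_contractible_of_symmetryKilling
    (hC : akbulutRuberman2016_symmetryKillingCobordism.{u}) :
    akbulutRuberman2016_theoremA_contractible.{u} :=
  akbulutRuberman2016_theoremA_contractible_of_two_parts hC
    akbulutRuberman2016_relativelyExotic_holds

/-- **Thm. A for contractible `W` from the geometric core of (C)** — the outputs of Lemma 2.3
and of the Claim of §3 for `M = ∂W` (an invertible cobordism `X` from `∂W` to some `N` with the
extension property `FarEndDiffeosExtend X`, `∂W → X` an isomorphism on integral singular homology
and onto on fundamental groups), through
`akbulutRuberman2016_symmetryKillingCobordism_of_homologyCobordism`.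
[cite: AkbulutRuberman2016, Thm. A, Lemma 2.3 and §3 (Claim)] -/
theorem akbulutRuberman2016_theoremA_contractible_of_homologyCobordismCore
    (hcore : ∀ (W : Type u) [TopologicalSpace W] [T2Space W] [SecondCountableTopology W]
      [ChartedSpace (EuclideanHalfSpace 4) W] [IsManifold (𝓡∂ 4) ∞ W] [CompactSpace W]
      [ContractibleSpace W] (b : BoundaryData (𝓡∂ 4) W (𝓡 3)),
      ∃ (N : Type u) (_ : TopologicalSpace N) (_ : ChartedSpace (EuclideanSpace ℝ (Fin 3)) N)
        (_ : IsManifold (𝓡 3) ∞ N) (X : Cobordism 3 b.carrier N),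
        X.IsInvertible ∧ FarEndDiffeosExtend X ∧
        (∀ k, IsIso (singularHomology.map ℤ ℤ (⟨X.inl, X.continuous_inl⟩ : C(b.carrier, X.W)) k)) ∧
        (∀ x : b.carrier, Function.Surjective
          (FundamentalGroup.map (⟨X.inl, X.continuous_inl⟩ : C(b.carrier, X.W)) x))) :
    akbulutRuberman2016_theoremA_contractible.{u} :=
  akbulutRuberman2016_theoremA_contractible_of_symmetryKilling
    (akbulutRuberman2016_symmetryKillingCobordism_of_homologyCobordism hcore)

/-! ### Thm. B from a cork and (C) -/

/-- **Akbulut–Ruberman 2016, Thm. B (first assertion) from exactly two named leaves: a cork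
(`akbulut1991_mazurCork`, Akbulut 1991, Thms. 1-2) and the symmetry-killing cobordism (C).**
"Apply Theorem A to `(W, τ)`, a cork": `akbulutRuberman2016_theoremB_of_cork_symmetryKilling_relativelyExotic`
(`ExoticContractibleCorkHomeomorphProofs.lean`; the homeomorphism `V ≃ₜ V′` is `F ∪ id_X` for the
homeomorphism `F` of `W` extending the cork twist, so no Freedman–Quinn hypothesis occurs) with
(R) supplied by `akbulutRuberman2016_relativelyExotic_holds`.
[cite: AkbulutRuberman2016, Thm. B and its proof (§3)] [cite: Akbulut1991Fake, Thms. 1-2] -/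
theorem akbulutRuberman2016_theoremB_of_cork_symmetryKilling (hK : akbulut1991_mazurCork.{u})
    (hC : akbulutRuberman2016_symmetryKillingCobordism.{u}) :
    akbulutRuberman2016_theoremB.{u} :=
  akbulutRuberman2016_theoremB_of_cork_symmetryKilling_relativelyExotic hK hC
    akbulutRuberman2016_relativelyExotic_holds

/-- **Thm. B from a cork and the geometric core of (C)** (Lemma 2.3 with Cor. 2.5 and Prop. 2.6,
and the Claim of §3 — the 3-manifold inputs of the paper; everything else in the printed proofs of
Thms. A and B is formal): through `akbulutRuberman2016_symmetryKillingCobordism_of_homologyCobordism`.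
[cite: AkbulutRuberman2016, Thm. B, Lemma 2.3, Cor. 2.5, Prop. 2.6 and §3] [cite: Akbulut1991Fake, Thms. 1-2] -/
theorem akbulutRuberman2016_theoremB_of_cork_homologyCobordismCore (hK : akbulut1991_mazurCork.{u})
    (hcore : ∀ (W : Type u) [TopologicalSpace W] [T2Space W] [SecondCountableTopology W]
      [ChartedSpace (EuclideanHalfSpace 4) W] [IsManifold (𝓡∂ 4) ∞ W] [CompactSpace W]
      [ContractibleSpace W] (b : BoundaryData (𝓡∂ 4) W (𝓡 3)),
      ∃ (N : Type u) (_ : TopologicalSpace N) (_ : ChartedSpace (EuclideanSpace ℝ (Fin 3)) N)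
        (_ : IsManifold (𝓡 3) ∞ N) (X : Cobordism 3 b.carrier N),
        X.IsInvertible ∧ FarEndDiffeosExtend X ∧
        (∀ k, IsIso (singularHomology.map ℤ ℤ (⟨X.inl, X.continuous_inl⟩ : C(b.carrier, X.W)) k)) ∧
        (∀ x : b.carrier, Function.Surjective
          (FundamentalGroup.map (⟨X.inl, X.continuous_inl⟩ : C(b.carrier, X.W)) x))) :
    akbulutRuberman2016_theoremB.{u} :=
  akbulutRuberman2016_theoremB_of_cork_symmetryKilling hK
    (akbulutRuberman2016_symmetryKillingCobordism_of_homologyCobordism hcore)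

/-- **The barrier `ContractibleBarrierFour` from a cork and (C)** (through Thm. B,
`contractibleBarrierFour_of_akbulutRuberman`). Compare
`contractibleBarrierFour_of_cork_symmetryKilling_relativelyExotic[_freedmanQuinn]`, whose
hypotheses (R) and Freedman–Quinn are gone.
[cite: AkbulutRuberman2016, Thm. B and its proof (§3)] -/
theorem contractibleBarrierFour_of_cork_symmetryKilling (hK : akbulut1991_mazurCork.{u})
    (hC : akbulutRuberman2016_symmetryKillingCobordism.{u}) :
    ContractibleBarrierFour.{u} :=
  contractibleBarrierFour_of_akbulutRuberman
    (akbulutRuberman2016_theoremB_of_cork_symmetryKilling hK hC)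

/-- The same with the cork supplied in the tree's sense (`Literature.Topology.FourManifolds.IsCork`,
any cork on a second countable `W`), through `akbulut1991_mazurCork_of_isCork`.
[cite: AkbulutRuberman2016, §1 and proof of Thm. B] -/
theorem contractibleBarrierFour_of_isCork_symmetryKilling
    (h : ∃ (W : Type u) (_ : TopologicalSpace W) (_ : SecondCountableTopology W)
      (_ : ChartedSpace (EuclideanHalfSpace 4) W) (_ : IsManifold (𝓡∂ 4) ∞ W)
      (b : BoundaryData (𝓡∂ 4) W (𝓡 3)) (τ : b.carrier ≃ₘ⟮𝓡 3, 𝓡 3⟯ b.carrier), IsCork b τ)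
    (hC : akbulutRuberman2016_symmetryKillingCobordism.{u}) :
    ContractibleBarrierFour.{u} :=
  contractibleBarrierFour_of_cork_symmetryKilling (akbulut1991_mazurCork_of_isCork h) hC

/-! ### The alternative leaf sets below the cork fact -/

/-- **Thm. B from the three leaves of the historical proof**: Akbulut 1991, Thm. 2 (`hA`: the
Mazur cork twist extends to no self-diffeomorphism; gauge theory), Freedman–Quinn 11.1C (`hF`: it
extends to a self-homeomorphism; the disc embedding theorem) — together the cork fact, through
`akbulut1991_mazurCork_of_notExtendsToDiffeomorph` — and (C).
[cite: AkbulutRuberman2016, Thm. B and its proof (§3)] [cite: Akbulut1991Fake, Thm. 2] [cite: FreedmanQuinn1990, Prop. 11.1C (trivial group)] -/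
theorem akbulutRuberman2016_theoremB_of_notExtendsToDiffeomorph_freedmanQuinn_symmetryKilling
    (hA : akbulut1991_notExtendsToDiffeomorph.{u})
    (hF : freedmanQuinn1990_homeomorph_extends_contractible.{u})
    (hC : akbulutRuberman2016_symmetryKillingCobordism.{u}) :
    akbulutRuberman2016_theoremB.{u} :=
  akbulutRuberman2016_theoremB_of_cork_symmetryKilling
    (akbulut1991_mazurCork_of_notExtendsToDiffeomorph hA hF) hC

/-- **Thm. B at every universe from Kang 2022, Thm. 1.1 and Freedman–Quinn at universe `0`
(together the cork fact at every universe, `akbulut1991_mazurCork_of_theorem11_univ`) and (C) at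
the target universe.**
[cite: AkbulutRuberman2016, Thm. B and its proof (§3)] [cite: Kang2022OneStabilization, Thm. 1.1] [cite: FreedmanQuinn1990, Prop. 11.1C (trivial group)] -/
theorem akbulutRuberman2016_theoremB_of_theorem11_freedmanQuinn_symmetryKilling
    (h11 : kang2022_theorem11) (hF : freedmanQuinn1990_homeomorph_extends_contractible.{0})
    (hC : akbulutRuberman2016_symmetryKillingCobordism.{u}) :
    akbulutRuberman2016_theoremB.{u} :=
  akbulutRuberman2016_theoremB_of_cork_symmetryKilling
    (akbulut1991_mazurCork_of_theorem11_univ h11 hF) hC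

end Literature.Barriers.SmoothPoincare4

end
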